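import Summits.HodgeConjecture.HodgeConjecture.Theorems.R90S4OneDimCharClass               -- ★ p863330 (LK-1D): `packetH_singleton_and_eq_singleton_of_finrank_eq_one` (conj. 1 = `IsRogPacketH {⟦ℂ_ξ⟧}` unfolded)
import Summits.HodgeConjecture.HodgeConjecture.Theorems.R90S4HLocCharNormEqOneNonsplit      -- ★ p863517 (U-ns): `isUnitarizable_mk_ofChar_HLoc_nonsplit`
import Literature.NumberTheory.Automorphic.UnitaryGroupPrincipalSeriesH                      -- ★ `cmPrincipalSeriesH`, `torusCharPair` (the excluded principal series of Thm. 13.1.1 (2))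
import Literature.NumberTheory.Rogawski1990.XiLocalCharacter                                 -- ★ `localDet`
import HarnessLib

/-!
# R90-TF · S4 (Ch. 13.1–2) · (APKT-i), HYPOTHESIS-FIRST EDITION — «`{⟦ℂ_ξ⟧}` IS A CARRIER at a non-split place, GIVEN (EXC-1D)»: the assembly of
# LC-APKT clause (i) from ★ (LK-1D) p863330, the (EXC-1D) letter as a HYPOTHESIS, and ★ (U-ns) p863517 (Rogawski 1990 §13.1 Thm. 13.1.1 (2)–(3), p. 199 ¶3)

Cell `hodgecm-mathlib`, crux H413 (`stmt-HodgeConjecture-24833`, lane `--supports … --as helper`, count-neutral), route of record `HCCMUnconditional`;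
programme R90-TF (brief `director/R90-BRIEF.v2.md` 1f40d54518340a35), section S4 = Rogawski Ch. 13.1–2 (base `R90-C131`), RULINGS S4-R19 (3) ∕ S4-R24 (1) brick
**(APKT-i)**, filed HYPOTHESIS-FIRST per the S4 dealer K2E2-plan (g7) 2026-09-05T00:23:44Z (D-0071); hand R90-C131-p04 (g2).  THEOREMS ONLY (no definition, no
instance, no notation, no named fact, no `sorry`); ★-only imports; no `Lines` import (L9: FILE A's `IsCarrierH` :155 and FILE B's `IsRogPacketH` :230 ∕
`IsExcludedPSMember` :353 are met by their UNFOLDED bodies, byte for byte — the fold `IsCarrierH L v μ {IrrClass.mk (SmoothIrrep.ofChar ξ hξ)} := <head> L v hns μ ξ hξ hexc`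
with `hexc : ¬ IsExcludedPSMember L v μ _` BY NAME is kernel-checked at HOME, `R90/R90-C131-p04/g2/probe_APKTi_fold.lean`).

WHAT.  FILE A of S4 (`Cruxes/H413/Lines/R90_S4_LocalKitExportA.lean`, ED. 4 @4359c8789e2f) states the sub-socket LC-APKT `stub_R90_S4_lc_aPkt`, whose clause (i)
«the singleton `{⟦ℂ_ξ⟧}` is a CARRIER» is `IsCarrierH L v μ {⟦ℂ_ξ⟧} := IsRogPacketH L v {⟦ℂ_ξ⟧} ∧ ¬ IsExceptionalH L v μ {⟦ℂ_ξ⟧} ∧ ∃ σ ∈ {⟦ℂ_ξ⟧}, σ.IsUnitarizable`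
(A :155; `IsExceptionalH μ S := ∃ σ ∈ S, IsExcludedPSMember L v μ σ`, A :142).  Here, at a NON-SPLIT `v` and for ANY `μ`:
* conjunct 1 `IsRogPacketH L v {⟦ℂ_ξ⟧}` (unfolded) is ★ (LK-1D) `packetH_singleton_and_eq_singleton_of_finrank_eq_one L v ℂ_ξ _ |>.1` (p863330), with `finrank ℂ ℂ_ξ = 1`
  (`finrank_ofChar_V_eq_one`, ★ `SmoothIrrep.ofChar_V` is `rfl`);
* conjunct 2 `¬ IsExceptionalH` reduces on the one member to the (EXC-1D) letter «`⟦ℂ_ξ⟧` is not a constituent of an excluded principal series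
  `i_H(‖·‖^{±1} μ⁻¹, χ₂)`» = `¬ IsExcludedPSMember L v μ ⟦ℂ_ξ⟧` (B :353–:361 bytes, unfolded) — taken as the HYPOTHESIS `hexc` (its payer is
  `Theorems/R90S4OneDimNotExcludedPSMember.lean`, R90-C131-p01 (g2), in flight; the `hexc`-free corollary keyed to that ★ name is the sequel file
  `Theorems/R90S4OneDimCarrierH.lean`);
* conjunct 3 is ★ (U-ns) `isUnitarizable_mk_ofChar_HLoc_nonsplit` (p863517): smooth characters of `H_v` are unitary at a non-split `v`.
HEAD `isCarrierH_singleton_ofChar_nonsplit_of_notExcluded (L) (v) (hns) (μ) (ξ) (hξ) (hexc)`.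

HONEST LABEL: count-neutral helper (lane `--supports`); it pays clause (i) of ONE of the five open `_lc_*` laws of FILE A only MODULO (EXC-1D) and only once folded by an A
edition; nothing here bears on clause (ii) of LC-APKT (global) or on LC-CARD ∕ SIGN ∕ OVERLAP ∕ UNRAM.  HC_CM is proved only modulo the 7 printed citations (2 remaining
named inputs: hLiu418 = `stmt-HodgeConjecture-24832`, h413 = `stmt-HodgeConjecture-24833`) until rung 0 closes.  REL ≠ ★ ≠ BUILT.

## References
* [Rogawski1990] J. D. Rogawski, *Automorphic Representations of Unitary Groups in Three Variables*, Ann. of Math. Stud. 123 (1990): §13.1 Thm. 13.1.1 (2)–(3) p. 198,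
  p. 199 ¶3 («no twist of `ρ` is unitary»), Prop. 13.1.4 p. 199 (`Π(ξ)`, `dim ξ = 1`); §12.1 p. 171 (`ρ = ρ₁ ⊗ χ`); §12.2 p. 173 (the excluded principal series).
* [BushnellHenniart2006] C. J. Bushnell, G. Henniart, *The Local Langlands Conjecture for GL(2)* (2006), §1.5, §11.1 (characters as one-dimensional smooth representations).
-/

set_option autoImplicit false
-- the mandated namespace repeats the single-problem summit's segment (`HodgeConjecture.HodgeConjecture`)
set_option linter.dupNamespace false

noncomputable section

open NumberField IsDedekindDomain Matrix Topology
open Literature.NumberTheory.Automorphic Literature.NumberTheory.Automorphic.UnitaryGroup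
open Literature.NumberTheory.Rogawski1990
open scoped MatrixGroups

namespace Summit.HodgeConjecture.HodgeConjecture.R90.S4

variable (L : Type) [Field L] [NumberField L] [IsCMField L] (v : HeightOneSpectrum (𝓞 ↥(maximalRealSubfield L)))
  (hns : ∀ w : PlacesOver L v, IsCMField.complexConj L • w.1 = w.1)

/-- `ℂ_ξ` is one-dimensional (`(SmoothIrrep.ofChar ξ hξ).V = ℂ`, ★ `SmoothIrrep.ofChar_V`). [cite: BushnellHenniart2006, §1.5] -/
theorem finrank_ofChar_V_eq_one {G : Type} [Group G] [TopologicalSpace G] [IsTopologicalGroup G]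
    (ξ : G →* ℂˣ) (hξ : IsOpen ((ξ.ker : Subgroup G) : Set G)) :
    Module.finrank ℂ (SmoothIrrep.ofChar ξ hξ).V = 1 :=
  Module.finrank_self ℂ

set_option maxHeartbeats 400000 in
include hns in
/-- **(APKT-i), HYPOTHESIS-FIRST — `IsCarrierH L v μ {⟦ℂ_ξ⟧}` (FILE A :155, UNFOLDED) at a non-split `v`, GIVEN the (EXC-1D) letter `hexc`** («`⟦ℂ_ξ⟧` is not a constituent
of an excluded principal series `i_H(‖·‖^{±1} μ⁻¹, χ₂)`», FILE B's `IsExcludedPSMember L v μ ⟦ℂ_ξ⟧` unfolded): conjunct 1 `IsRogPacketH L v {⟦ℂ_ξ⟧}` (unfolded) is ★ (LK-1D)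
`packetH_singleton_and_eq_singleton_of_finrank_eq_one … |>.1` at `r := ℂ_ξ`; conjunct 2 `¬ IsExceptionalH` is `hexc` on the one member; conjunct 3 is ★ (U-ns)
`isUnitarizable_mk_ofChar_HLoc_nonsplit`. [cite: Rogawski1990, §13.1 Thm. 13.1.1 (2)–(3) p. 198, p. 199 ¶3; §12.1 p. 171] -/
theorem isCarrierH_singleton_ofChar_nonsplit_of_notExcluded (μ : (LocalRing L v)ˣ →* ℂˣ)
    (ξ : ((cmDatum L 2 (Matrix.of fun i j : Fin 2 => if i.val + j.val + 1 = 2 then (1 : L) else 0)).Local v ×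
      (cmDatum L 1 (Matrix.of fun i j : Fin 1 => if i.val + j.val + 1 = 1 then (1 : L) else 0)).Local v) →* ℂˣ)
    (hξ : IsOpen ((ξ.ker : Subgroup ((cmDatum L 2 (Matrix.of fun i j : Fin 2 => if i.val + j.val + 1 = 2 then (1 : L) else 0)).Local v ×
      (cmDatum L 1 (Matrix.of fun i j : Fin 1 => if i.val + j.val + 1 = 1 then (1 : L) else 0)).Local v)) :
        Set ((cmDatum L 2 (Matrix.of fun i j : Fin 2 => if i.val + j.val + 1 = 2 then (1 : L) else 0)).Local v ×
          (cmDatum L 1 (Matrix.of fun i j : Fin 1 => if i.val + j.val + 1 = 1 then (1 : L) else 0)).Local v)))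
    (hexc : ¬ ∃ (χ₁ : (LocalRing L v)ˣ →* ℂˣ) (χ₂ : ↥(normOneUnits (conjLocal L (IsCMField.complexConj L) v)) →* ℂˣ),
      (χ₁ = halfModulusChar (LocalRing L v) ^ 2 * μ⁻¹ ∨ χ₁ = (halfModulusChar (LocalRing L v) ^ 2)⁻¹ * μ⁻¹) ∧
      IsOpen ((χ₂.ker : Subgroup ↥(normOneUnits (conjLocal L (IsCMField.complexConj L) v))) :
        Set ↥(normOneUnits (conjLocal L (IsCMField.complexConj L) v))) ∧
      (IrrClass.mk (SmoothIrrep.ofChar ξ hξ)).IsConstituentOf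
        (cmPrincipalSeriesH L v
          (torusCharPair (conjLocal L (IsCMField.complexConj L) v) (cmLocalForm L 2 v) (cmLocalForm_eq_over L 2 v) 0 χ₁ χ₂)
          (χ₂.comp (localDet (IsCMField.complexConj L) v (isUnit_antidiagOne_det L 1))))) :
    -- `IsRogPacketH L v {⟦ℂ_ξ⟧}`, unfolded
    (∃ (O : Finset (IrrClass ((cmDatum L 2 (Matrix.of fun i j : Fin 2 => if i.val + j.val + 1 = 2 then (1 : L) else 0)).Local v)))
        (χ : (cmDatum L 1 (Matrix.of fun i j : Fin 1 => if i.val + j.val + 1 = 1 then (1 : L) else 0)).Local v →* ℂˣ)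
        (hχ : IsOpen ((χ.ker : Subgroup ((cmDatum L 1 (Matrix.of fun i j : Fin 1 => if i.val + j.val + 1 = 1 then (1 : L) else 0)).Local v)) :
          Set ((cmDatum L 1 (Matrix.of fun i j : Fin 1 => if i.val + j.val + 1 = 1 then (1 : L) else 0)).Local v))),
        (∃ σ : IrrClass ((cmDatum L 2 (Matrix.of fun i j : Fin 2 => if i.val + j.val + 1 = 2 then (1 : L) else 0)).Local v),
          σ.IsAdmissible ∧ ∀ c, c ∈ O ↔
            ∃ (T : GL (Fin 2) (LocalRing L v)) (a : LocalRing L v) (ha : IsUnit a)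
              (h : formCongr (conjLocal L (IsCMField.complexConj L) v) T
                  ((Matrix.of fun i j : Fin 2 => if i.val + j.val + 1 = 2 then (1 : L) else 0).map (algebraMap L (LocalRing L v))) =
                a • (Matrix.of fun i j : Fin 2 => if i.val + j.val + 1 = 2 then (1 : L) else 0).map (algebraMap L (LocalRing L v))),
              c = IrrClass.comap (cmDatumLocalCongr L v T ha h) σ) ∧
        ({IrrClass.mk (SmoothIrrep.ofChar ξ hξ)} :
            Finset (IrrClass ((cmDatum L 2 (Matrix.of fun i j : Fin 2 => if i.val + j.val + 1 = 2 then (1 : L) else 0)).Local v ×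
              (cmDatum L 1 (Matrix.of fun i j : Fin 1 => if i.val + j.val + 1 = 1 then (1 : L) else 0)).Local v))) =
          O.map ⟨IrrClass.boxChar χ hχ, IrrClass.boxChar_injective χ hχ⟩) ∧
    -- `¬ IsExceptionalH L v μ {⟦ℂ_ξ⟧}`, unfolded
    (¬ ∃ σ ∈ ({IrrClass.mk (SmoothIrrep.ofChar ξ hξ)} :
          Finset (IrrClass ((cmDatum L 2 (Matrix.of fun i j : Fin 2 => if i.val + j.val + 1 = 2 then (1 : L) else 0)).Local v ×
            (cmDatum L 1 (Matrix.of fun i j : Fin 1 => if i.val + j.val + 1 = 1 then (1 : L) else 0)).Local v))),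
      ∃ (χ₁ : (LocalRing L v)ˣ →* ℂˣ) (χ₂ : ↥(normOneUnits (conjLocal L (IsCMField.complexConj L) v)) →* ℂˣ),
        (χ₁ = halfModulusChar (LocalRing L v) ^ 2 * μ⁻¹ ∨ χ₁ = (halfModulusChar (LocalRing L v) ^ 2)⁻¹ * μ⁻¹) ∧
        IsOpen ((χ₂.ker : Subgroup ↥(normOneUnits (conjLocal L (IsCMField.complexConj L) v))) :
          Set ↥(normOneUnits (conjLocal L (IsCMField.complexConj L) v))) ∧
        σ.IsConstituentOf
          (cmPrincipalSeriesH L v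
            (torusCharPair (conjLocal L (IsCMField.complexConj L) v) (cmLocalForm L 2 v) (cmLocalForm_eq_over L 2 v) 0 χ₁ χ₂)
            (χ₂.comp (localDet (IsCMField.complexConj L) v (isUnit_antidiagOne_det L 1))))) ∧
    -- `∃ σ ∈ {⟦ℂ_ξ⟧}, σ.IsUnitarizable`
    (∃ σ ∈ ({IrrClass.mk (SmoothIrrep.ofChar ξ hξ)} :
          Finset (IrrClass ((cmDatum L 2 (Matrix.of fun i j : Fin 2 => if i.val + j.val + 1 = 2 then (1 : L) else 0)).Local v ×
            (cmDatum L 1 (Matrix.of fun i j : Fin 1 => if i.val + j.val + 1 = 1 then (1 : L) else 0)).Local v))),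
      σ.IsUnitarizable) := by
  refine ⟨(packetH_singleton_and_eq_singleton_of_finrank_eq_one L v (SmoothIrrep.ofChar ξ hξ) (finrank_ofChar_V_eq_one ξ hξ)).1, ?_,
    ⟨IrrClass.mk (SmoothIrrep.ofChar ξ hξ), Finset.mem_singleton_self _, isUnitarizable_mk_ofChar_HLoc_nonsplit L v hns ξ hξ⟩⟩
  rintro ⟨σ, hσ, hex⟩
  rw [Finset.mem_singleton] at hσ
  subst hσ
  exact hexc hex

end Summit.HodgeConjecture.HodgeConjecture.R90.S4

end
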